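import Summits.AnomalousDissipation.AnomalousDissipation.Theorems.QuasiStaticSolenoidalCellTensorQ.Negative.IsotropyProj
import Summits.AnomalousDissipation.AnomalousDissipation.Theorems.SolenoidalFractalHomogenisationRealisedQuasiStaticCellLawOutOfPlaneBlock
import Summits.AnomalousDissipation.AnomalousDissipation.Theorems.SolenoidalFractalHomogenisationRealisedQuasiStaticCellLawCellSlotFormulas
import HarnessLib

/-!
# Negative side of K2Q `QuasiStaticSolenoidalCellTensorQ` (stmt-AnomalousDissipation-19072): the value of the frozen drain
# constants of a window — isotropy and the `|ℓ|/n` corrections (helper, `--supports stmt-AnomalousDissipation-19072`)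

Summits-side helper file (everything proved; no definitions, no named facts).  The window step (`window_step`) leaves the
drain over `q` periods as `4q(1−4ρ/3)Σ_j τ_j Γ_j` with frozen per-slot constants `Γ_j` carrying `‖Π_{ℓ∓K_j} v₀‖²/|ℓ∓K_j|²`
(`K_j = n m_j`, `v₀ ⊥ ℓ` the principal vector at the window start).  Here:
* `norm_leraySym_cellFreq` — `‖Π_{n m} v‖ = ‖Π_m v‖`;
* `norm_sq_leraySym_shift_le` — for `v ⊥ ℓ`: `‖Π_{K∓ℓ} v‖² ≤ ‖Π_K v‖² + 3(|ℓ|/|K|)‖v‖²`;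
* `inv_freqNormSq_shift_le` — `1/|ℓ∓K_j|² ≤ 1/(n²|m_j|²(1−|ℓ|/n)²)`;
* `layerAmp_sq_sum` — `‖a_j‖² + ‖a'_j‖² = 1/(8π²|m_j|²)`; `slotDot_sq_le` — `(ê_j·ℓ)² ≤ |ℓ|²`;
* `drain_value_le` — with `IsotropicWordGain W c₀` (`isotropic_proj_sum`):
  `4q(1−4ρ/3)Σ_jτ_jΓ_j ≤ q(1−4ρ/3)·(P|ℓ|²/(2π²κn⁴(1−θ)²))·[(1+ε)(32π⁴c₀ + 3θ)‖v₀‖² + (1+1/ε)δ²]`, `θ = |ℓ|/n`.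
This is NOT a proof of anomalous dissipation, and by itself not of `¬ K2Q`.
-/

set_option linter.dupNamespace false

noncomputable section

namespace Summit.AnomalousDissipation.AnomalousDissipation.Theorems.QuasiStaticSolenoidalCellTensorQ.Negative

open Set Function Complex
open scoped InnerProductSpace ComplexConjugate BigOperators
open Literature.Analysis Literature.Analysis.FunctionSpaces Literature.Analysis.FunctionSpaces.Torus
open Literature.Analysis.FluidPDE Literature.Analysis.FluidPDE.LatticeShear
open Summit.AnomalousDissipation.AnomalousDissipation.Theorems.SolenoidalFractalHomogenisation.PermissibleCarrier
open Summit.AnomalousDissipation.AnomalousDissipation.Theorems.SolenoidalFractalHomogenisation.RealisedQuasiStaticCellLaw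

variable {k₀ : ℕ}

/-! ## §1 Geometry of the fed frequencies -/

/-- `‖Π_{n m} v‖ = ‖Π_m v‖` (`n ≥ 1`, `m ≠ 0`): the Leray symbol depends only on the direction of the frequency. -/
theorem norm_sq_leraySym_cellFreq {m : Fin 3 → ℤ} (hm : m ≠ 0) {n : ℕ} (hn : 0 < n) (v : EuclideanSpace ℂ (Fin 3)) :
    ‖Torus.leraySym (fun i => m i * (n : ℤ)) v‖ ^ 2 = ‖Torus.leraySym m v‖ ^ 2 := by
  rw [norm_sq_leraySym_eq (cellFreq_ne_zero' hm hn) v, norm_sq_leraySym_eq hm v, freqNormSq_cellFreq]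
  have hsum : ∑ i, (((fun i => m i * (n : ℤ)) i : ℤ) : ℂ) * v i = (n : ℂ) * ∑ i, (m i : ℂ) * v i := by
    rw [Finset.mul_sum]
    refine Finset.sum_congr rfl fun i _ => ?_
    push_cast; ring
  rw [hsum, norm_mul, Complex.norm_natCast, mul_pow]
  have hn' : (0:ℝ) < n := by exact_mod_cast hn
  have hf : 0 < freqNormSq m := lt_of_lt_of_le one_pos (Torus.one_le_freqNormSq_of_ne_zero hm)
  field_simp
where
  /-- the cell frequency of a non-zero lattice vector is non-zero -/
  cellFreq_ne_zero' {m : Fin 3 → ℤ} (hm : m ≠ 0) {n : ℕ} (hn : 0 < n) : (fun i => m i * (n : ℤ)) ≠ 0 := by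
    intro h; apply hm; funext i
    have hi := congrFun h i
    simp only [Pi.zero_apply, mul_eq_zero, Int.natCast_eq_zero] at hi
    rcases hi with hi | hi
    · exact hi
    · exact absurd hi hn.ne'

/-- **Shifting the frequency by `ℓ ⊥ v` changes the Leray norm little**: for `v` with `Σℓᵢvᵢ = 0`, `K ≠ 0`, `K + σℓ ≠ 0`,
`‖K + σℓ‖ ≤ ‖K‖ + ‖ℓ‖` (σ = ±1): `‖Π_{K+σℓ} v‖² ≤ ‖Π_K v‖² + 3(|ℓ|/|K|)‖v‖²`. -/
theorem norm_sq_leraySym_shift_le {K L v} (hK : K ≠ 0) (hKL : K + L ≠ 0) (hv : ∑ i, ((L : Fin 3 → ℤ) i : ℂ) * v i = 0)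
    (hLK : ‖latticeVec L‖ ≤ ‖latticeVec K‖) :
    ‖Torus.leraySym (K + L) v‖ ^ 2 ≤ ‖Torus.leraySym K v‖ ^ 2 + 3 * (‖latticeVec L‖ / ‖latticeVec K‖) * ‖v‖ ^ 2 := by
  rw [norm_sq_leraySym_eq hKL, norm_sq_leraySym_eq hK]
  have hsum : ∑ i, (((K + L) i : ℤ) : ℂ) * v i = ∑ i, (K i : ℂ) * v i := by
    have : ∑ i, (((K + L) i : ℤ) : ℂ) * v i = ∑ i, (K i : ℂ) * v i + ∑ i, (L i : ℂ) * v i := by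
      rw [← Finset.sum_add_distrib]; refine Finset.sum_congr rfl fun i _ => ?_
      simp only [Pi.add_apply]; push_cast; ring
    rw [this, hv, add_zero]
  rw [hsum]
  set s : ℝ := ‖∑ i, (K i : ℂ) * v i‖ ^ 2 with hs
  set a : ℝ := ‖latticeVec K‖ with ha
  set b : ℝ := ‖latticeVec L‖ with hb
  have ha0 : 0 < a := lt_of_lt_of_le one_pos (one_le_norm_latticeVec hK)
  have hb0 : 0 ≤ b := norm_nonneg _
  have hfK : freqNormSq K = a ^ 2 := (norm_latticeVec_sq K).symm
  have hKL' : ‖latticeVec (K + L)‖ ≤ a + b := by rw [latticeVec_add]; exact norm_add_le _ _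
  have hfKL0 : 0 < freqNormSq (K + L) := lt_of_lt_of_le one_pos (Torus.one_le_freqNormSq_of_ne_zero hKL)
  have hfKL : freqNormSq (K + L) ≤ (a + b) ^ 2 := by
    rw [← norm_latticeVec_sq]; exact pow_le_pow_left₀ (norm_nonneg _) hKL' 2
  -- Cauchy–Schwarz: `s ≤ a² ‖v‖²`
  have hcs : s ≤ a ^ 2 * ‖v‖ ^ 2 := by
    have h1 : ‖∑ i, (K i : ℂ) * v i‖ ≤ ‖Torus.freqVec K‖ * ‖v‖ := by
      rw [← Torus.inner_freqVec_left]; exact norm_inner_le_norm _ _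
    have hfv : ‖Torus.freqVec K‖ ^ 2 = a ^ 2 := by
      rw [← hfK, EuclideanSpace.norm_sq_eq, freqNormSq]
      refine Finset.sum_congr rfl fun i _ => ?_
      rw [Torus.freqVec_apply, Complex.norm_intCast]; simp
    have h2 := pow_le_pow_left₀ (norm_nonneg _) h1 2
    rw [mul_pow, hfv] at h2
    exact h2
  have hs0 : 0 ≤ s := by positivity
  -- `s/a² − s/|K+L|² ≤ s(1/a² − 1/(a+b)²) ≤ 3(b/a)‖v‖²`
  rw [hfK]
  have h3 : s / a ^ 2 - s / freqNormSq (K + L) ≤ s / a ^ 2 - s / (a + b) ^ 2 := by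
    have := div_le_div_of_nonneg_left hs0 hfKL0 hfKL
    linarith
  have h4 : s / a ^ 2 - s / (a + b) ^ 2 ≤ 3 * (b / a) * ‖v‖ ^ 2 := by
    have hab : 0 < a + b := by linarith
    have e : s / a ^ 2 - s / (a + b) ^ 2 = s * ((2 * a * b + b ^ 2) / (a ^ 2 * (a + b) ^ 2)) := by
      field_simp; ring
    rw [e]
    have h5 : (2 * a * b + b ^ 2) / (a ^ 2 * (a + b) ^ 2) ≤ 3 * b / a ^ 3 := by
      rw [div_le_div_iff₀ (by positivity) (by positivity)]
      have hba : b ≤ a := hLK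
      nlinarith [mul_nonneg hb0 ha0.le, mul_nonneg (mul_nonneg hb0 hb0) (mul_nonneg ha0.le ha0.le),
        mul_nonneg (mul_nonneg hb0 ha0.le) (mul_nonneg ha0.le ha0.le), mul_nonneg (mul_nonneg hb0 hb0) (mul_nonneg hb0 (mul_nonneg ha0.le ha0.le)),
        pow_pos ha0 4, mul_nonneg (pow_nonneg ha0.le 4) hb0, mul_nonneg (pow_nonneg ha0.le 3) (mul_nonneg hb0 hb0),
        mul_nonneg (pow_nonneg ha0.le 2) (pow_nonneg hb0 3)]
    calc s * ((2 * a * b + b ^ 2) / (a ^ 2 * (a + b) ^ 2)) ≤ (a ^ 2 * ‖v‖ ^ 2) * (3 * b / a ^ 3) :=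
          mul_le_mul hcs h5 (by positivity) (by positivity)
      _ = 3 * (b / a) * ‖v‖ ^ 2 := by field_simp
  linarith

/-- **Lower bound on a fed frequency**: `n²|m|²(1 − |ℓ|/n)² ≤ |K_j + σℓ|²` when `|ℓ| < n` (σ = ±1, via `L = σℓ`). -/
theorem freqNormSq_shift_ge (m : Fin 3 → ℤ) (hm : m ≠ 0) {n : ℕ} (hn : 0 < n) (L : Fin 3 → ℤ)
    (hL : ‖latticeVec L‖ < n) :
    (n : ℝ) ^ 2 * freqNormSq m * (1 - ‖latticeVec L‖ / n) ^ 2 ≤ freqNormSq ((fun i => m i * (n : ℤ)) + L) := by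
  have hn' : (0:ℝ) < n := by exact_mod_cast hn
  have hm1 := one_le_norm_latticeVec hm
  have hKn : ‖latticeVec (fun i => m i * (n : ℤ))‖ = (n : ℝ) * ‖latticeVec m‖ := by
    have : latticeVec (fun i => m i * (n : ℤ)) = (n : ℝ) • latticeVec m := by ext i; simp [latticeVec_apply, mul_comm]
    rw [this, norm_smul, Real.norm_eq_abs, abs_of_nonneg hn'.le]
  rw [← norm_latticeVec_sq, ← norm_latticeVec_sq, latticeVec_add]
  have hlow : (n : ℝ) * ‖latticeVec m‖ - ‖latticeVec L‖ ≤ ‖latticeVec (fun i => m i * (n : ℤ)) + latticeVec L‖ := by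
    have := norm_sub_norm_le (latticeVec (fun i => m i * (n : ℤ))) (-latticeVec L)
    rw [sub_neg_eq_add, norm_neg, hKn] at this
    linarith
  have h0 : 0 ≤ (n : ℝ) * ‖latticeVec m‖ - ‖latticeVec L‖ := by nlinarith
  have h1 : (n : ℝ) * ‖latticeVec m‖ * (1 - ‖latticeVec L‖ / n) ≤ (n : ℝ) * ‖latticeVec m‖ - ‖latticeVec L‖ := by
    have e : (n : ℝ) * ‖latticeVec m‖ * (1 - ‖latticeVec L‖ / n) = (n : ℝ) * ‖latticeVec m‖ - ‖latticeVec L‖ * ‖latticeVec m‖ := by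
      field_simp
    rw [e]
    nlinarith [norm_nonneg (latticeVec L)]
  have h2 : 0 ≤ (n : ℝ) * ‖latticeVec m‖ * (1 - ‖latticeVec L‖ / n) := by
    refine mul_nonneg (by positivity) ?_
    rw [sub_nonneg, div_le_one hn']; exact hL.le
  calc (n : ℝ) ^ 2 * ‖latticeVec m‖ ^ 2 * (1 - ‖latticeVec L‖ / n) ^ 2
      = ((n : ℝ) * ‖latticeVec m‖ * (1 - ‖latticeVec L‖ / n)) ^ 2 := by ring
    _ ≤ ((n : ℝ) * ‖latticeVec m‖ - ‖latticeVec L‖) ^ 2 := pow_le_pow_left₀ h2 h1 2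
    _ ≤ ‖latticeVec (fun i => m i * (n : ℤ)) + latticeVec L‖ ^ 2 := pow_le_pow_left₀ h0 hlow 2

/-- `‖a_j‖² + ‖a'_j‖² = 1/(8π²|m_j|²)`. -/
theorem layerAmp_sq_sum (P : LatticePhase) :
    ‖Complex.exp (P.φ * Complex.I) * (1 / (2 * ((2 * Real.pi * ‖latticeVec P.m‖ : ℝ) : ℂ) * Complex.I))‖ ^ 2 +
      ‖starRingEnd ℂ (Complex.exp (P.φ * Complex.I)) * (-(1 / (2 * ((2 * Real.pi * ‖latticeVec P.m‖ : ℝ) : ℂ) * Complex.I)))‖ ^ 2 =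
      1 / (8 * Real.pi ^ 2 * ‖latticeVec P.m‖ ^ 2) := by
  have h1 := norm_layerAmp P
  have h2 : ‖starRingEnd ℂ (Complex.exp (P.φ * Complex.I)) *
      (-(1 / (2 * ((2 * Real.pi * ‖latticeVec P.m‖ : ℝ) : ℂ) * Complex.I)))‖ = 1 / (2 * (2 * Real.pi * ‖latticeVec P.m‖)) := by
    rw [norm_mul, norm_neg, Complex.norm_conj, ← norm_mul]; exact h1
  rw [h1, h2]
  have := one_le_norm_latticeVec P.m_ne
  field_simp
  ring

/-- `(ê·ℓ)² ≤ |ℓ|²` for a unit `ê`. -/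
theorem slotDot_sq_le (P : LatticePhase) (ℓ : Fin 3 → ℤ) : (∑ i, P.e i * (ℓ i : ℝ)) ^ 2 ≤ freqNormSq ℓ := by
  have h : ∑ i, P.e i * (ℓ i : ℝ) = ⟪P.e, latticeVec ℓ⟫_ℝ := by
    rw [PiLp.inner_apply]; refine Finset.sum_congr rfl fun i _ => ?_; simp [latticeVec_apply, mul_comm]
  rw [h, ← norm_latticeVec_sq]
  have h1 := abs_real_inner_le_norm P.e (latticeVec ℓ)
  rw [P.e_unit, one_mul] at h1
  have := sq_abs ⟪P.e, latticeVec ℓ⟫_ℝ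
  nlinarith [abs_nonneg ⟪P.e, latticeVec ℓ⟫_ℝ, norm_nonneg (latticeVec ℓ)]

/-! ## §2 The drain constants of a window, summed with the slot durations -/

set_option maxHeartbeats 1600000 in
/-- **Value of the frozen drain constants.** For a word with `IsotropicWordGain W c₀`, `κ > 0`, `n ≥ 1`, a principal label
`ℓ ≠ 0` with `2|ℓ| < n`, a vector `v₀ ⊥ ℓ`, `ε ≥ 0` and `B ≥ 0`, with `θ = |ℓ|/n`:
`Σ_j τ_j Γ_j ≤ (P|ℓ|²/(8π²κn⁴(1−θ)²))·[(1+ε)(32π⁴c₀ + 3θ)‖v₀‖² + B]`, where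
`Γ_j = ½(1/n)²(2πΣᵢê_j,ᵢℓᵢ)²(‖a_j‖²+‖a'_j‖²)Σ_∓((1+ε)‖Π_{ℓ∓K_j}v₀‖² + B)/(κ4π²|ℓ∓K_j|²)`. -/
theorem drain_value_le (W : LatticeWord k₀) {c₀ : ℝ} (hW : IsotropicWordGain W c₀) {n : ℕ} (hn : 0 < n) {κ : ℝ} (hκ : 0 < κ)
    {ℓ : Fin 3 → ℤ} (hℓ : ℓ ≠ 0) (hℓn : 2 * ‖latticeVec ℓ‖ < n) (v₀ : EuclideanSpace ℂ (Fin 3))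
    (hv₀ : ∑ i, (ℓ i : ℂ) * v₀ i = 0) {ε B : ℝ} (hε : 0 ≤ ε) (hB : 0 ≤ B) :
    ∑ j : Fin k₀, (W.phase j).τ * ((1 / 2 : ℝ) * ((1 / (n : ℝ)) ^ 2 * (2 * Real.pi * ∑ i, (W.phase j).e i * (ℓ i : ℝ)) ^ 2) *
      (‖Complex.exp ((W.phase j).φ * Complex.I) *
          (1 / (2 * ((2 * Real.pi * ‖latticeVec (W.phase j).m‖ : ℝ) : ℂ) * Complex.I))‖ ^ 2 +
        ‖starRingEnd ℂ (Complex.exp ((W.phase j).φ * Complex.I)) *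
          (-(1 / (2 * ((2 * Real.pi * ‖latticeVec (W.phase j).m‖ : ℝ) : ℂ) * Complex.I)))‖ ^ 2) *
      (((1 + ε) * ‖Torus.leraySym (ℓ - (fun i => (W.phase j).m i * n)) v₀‖ ^ 2 + B) /
          (κ * (4 * Real.pi ^ 2 * freqNormSq (ℓ - (fun i => (W.phase j).m i * n)))) +
        ((1 + ε) * ‖Torus.leraySym (ℓ + (fun i => (W.phase j).m i * n)) v₀‖ ^ 2 + B) /
          (κ * (4 * Real.pi ^ 2 * freqNormSq (ℓ + (fun i => (W.phase j).m i * n)))))) ≤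
      W.period * freqNormSq ℓ / (8 * Real.pi ^ 2 * κ * (n : ℝ) ^ 4 * (1 - ‖latticeVec ℓ‖ / n) ^ 2) *
        ((1 + ε) * (32 * Real.pi ^ 4 * c₀ + 3 * (‖latticeVec ℓ‖ / n)) * ‖v₀‖ ^ 2 + B) := by
  have hn' : (0:ℝ) < n := by exact_mod_cast hn
  set θ : ℝ := ‖latticeVec ℓ‖ / n with hθ
  have hA : 0 < ‖latticeVec ℓ‖ := lt_of_lt_of_le one_pos (one_le_norm_latticeVec hℓ)
  have hθ0 : 0 ≤ θ := by positivity
  have hθ1 : θ < 1 / 2 := by rw [hθ, div_lt_iff₀ hn']; linarith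
  have h1θ : 0 < 1 - θ := by linarith
  have hℓn' : ‖latticeVec ℓ‖ < n := by linarith [norm_nonneg (latticeVec ℓ)]
  have hAf : freqNormSq ℓ = ‖latticeVec ℓ‖ ^ 2 := (norm_latticeVec_sq ℓ).symm
  -- termwise
  have hterm : ∀ j : Fin k₀, (W.phase j).τ * ((1 / 2 : ℝ) * ((1 / (n : ℝ)) ^ 2 * (2 * Real.pi * ∑ i, (W.phase j).e i * (ℓ i : ℝ)) ^ 2) *
      (‖Complex.exp ((W.phase j).φ * Complex.I) *
          (1 / (2 * ((2 * Real.pi * ‖latticeVec (W.phase j).m‖ : ℝ) : ℂ) * Complex.I))‖ ^ 2 +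
        ‖starRingEnd ℂ (Complex.exp ((W.phase j).φ * Complex.I)) *
          (-(1 / (2 * ((2 * Real.pi * ‖latticeVec (W.phase j).m‖ : ℝ) : ℂ) * Complex.I)))‖ ^ 2) *
      (((1 + ε) * ‖Torus.leraySym (ℓ - (fun i => (W.phase j).m i * n)) v₀‖ ^ 2 + B) /
          (κ * (4 * Real.pi ^ 2 * freqNormSq (ℓ - (fun i => (W.phase j).m i * n)))) +
        ((1 + ε) * ‖Torus.leraySym (ℓ + (fun i => (W.phase j).m i * n)) v₀‖ ^ 2 + B) /
          (κ * (4 * Real.pi ^ 2 * freqNormSq (ℓ + (fun i => (W.phase j).m i * n)))))) ≤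
      1 / (8 * Real.pi ^ 2 * κ * (n : ℝ) ^ 4 * (1 - θ) ^ 2) *
        ((1 + ε) * (32 * Real.pi ^ 4 * ((W.phase j).τ * (1 / (2 * (2 * Real.pi * ‖latticeVec (W.phase j).m‖) ^ 4)) *
          (∑ i, (W.phase j).e i * (ℓ i : ℝ)) ^ 2 * ‖Torus.leraySym (W.phase j).m v₀‖ ^ 2)) +
          ((1 + ε) * (3 * θ) * ‖v₀‖ ^ 2 + B) * ((W.phase j).τ * freqNormSq ℓ)) := by
    intro j
    set P := W.phase j with hPj
    set K : Fin 3 → ℤ := fun i => P.m i * (n : ℤ) with hK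
    have hm1 := one_le_norm_latticeVec P.m_ne
    have hfm : freqNormSq P.m = ‖latticeVec P.m‖ ^ 2 := (norm_latticeVec_sq _).symm
    have hKn : ‖latticeVec K‖ = (n : ℝ) * ‖latticeVec P.m‖ := by
      have : latticeVec K = (n : ℝ) • latticeVec P.m := by ext i; simp [hK, latticeVec_apply, mul_comm]
      rw [this, norm_smul, Real.norm_eq_abs, abs_of_nonneg hn'.le]
    have hK0 : K ≠ 0 := cellFreq_ne_zero P hn
    have hKge : (n : ℝ) ≤ ‖latticeVec K‖ := by rw [hKn]; nlinarith
    obtain ⟨-, -, -, -⟩ := principal_ne_cellFreq P hn hℓn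
    obtain ⟨-, ⟨z1, z2, -, -⟩, -⟩ := fourModes_facts P hn hℓ hℓn
    -- amplitudes
    rw [layerAmp_sq_sum P]
    -- the two fed frequencies as `K + L`
    have eminus : ℓ - K = -(K + (-ℓ)) := by abel
    have eplus : ℓ + K = K + ℓ := add_comm _ _
    have hKm : K + (-ℓ) ≠ 0 := by intro h; apply z1; rw [eminus, h, neg_zero]
    have hKp : K + ℓ ≠ 0 := by rw [← eplus]; exact z2
    have hvneg : ∑ i, ((-ℓ) i : ℂ) * v₀ i = 0 := by
      have : ∑ i, ((-ℓ) i : ℂ) * v₀ i = -∑ i, (ℓ i : ℂ) * v₀ i := by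
        rw [← Finset.sum_neg_distrib]; refine Finset.sum_congr rfl fun i _ => ?_; simp
      rw [this, hv₀, neg_zero]
    have hLm : ‖latticeVec (-ℓ)‖ ≤ ‖latticeVec K‖ := by rw [latticeVec_neg, norm_neg]; linarith
    have hLp : ‖latticeVec ℓ‖ ≤ ‖latticeVec K‖ := by linarith
    -- projections
    have hPm : ‖Torus.leraySym (ℓ - K) v₀‖ ^ 2 ≤ ‖Torus.leraySym P.m v₀‖ ^ 2 + 3 * θ * ‖v₀‖ ^ 2 := by
      rw [eminus, Torus.leraySym_neg_freq]
      refine (norm_sq_leraySym_shift_le hK0 hKm hvneg hLm).trans ?_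
      rw [norm_sq_leraySym_cellFreq P.m_ne hn, latticeVec_neg, norm_neg]
      have : ‖latticeVec ℓ‖ / ‖latticeVec K‖ ≤ θ := by
        rw [hθ]; exact div_le_div_of_nonneg_left hA.le hn' hKge
      nlinarith [sq_nonneg ‖v₀‖]
    have hPp : ‖Torus.leraySym (ℓ + K) v₀‖ ^ 2 ≤ ‖Torus.leraySym P.m v₀‖ ^ 2 + 3 * θ * ‖v₀‖ ^ 2 := by
      rw [eplus]
      refine (norm_sq_leraySym_shift_le hK0 hKp hv₀ hLp).trans ?_
      rw [norm_sq_leraySym_cellFreq P.m_ne hn]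
      have : ‖latticeVec ℓ‖ / ‖latticeVec K‖ ≤ θ := by
        rw [hθ]; exact div_le_div_of_nonneg_left hA.le hn' hKge
      nlinarith [sq_nonneg ‖v₀‖]
    -- frequencies
    set wlow : ℝ := κ * (4 * Real.pi ^ 2 * ((n : ℝ) ^ 2 * freqNormSq P.m * (1 - θ) ^ 2)) with hwlow
    have hwlow0 : 0 < wlow := by
      rw [hwlow]; have : 0 < freqNormSq P.m := by rw [hfm]; positivity
      positivity
    have hwm : wlow ≤ κ * (4 * Real.pi ^ 2 * freqNormSq (ℓ - K)) := by
      rw [hwlow, eminus, freqNormSq_neg]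
      refine mul_le_mul_of_nonneg_left (mul_le_mul_of_nonneg_left ?_ (by positivity)) hκ.le
      have h := freqNormSq_shift_ge P.m P.m_ne hn (-ℓ) (by rw [latticeVec_neg, norm_neg]; exact hℓn')
      rw [latticeVec_neg, norm_neg] at h
      exact h
    have hwp : wlow ≤ κ * (4 * Real.pi ^ 2 * freqNormSq (ℓ + K)) := by
      rw [hwlow, eplus]
      refine mul_le_mul_of_nonneg_left (mul_le_mul_of_nonneg_left ?_ (by positivity)) hκ.le
      exact freqNormSq_shift_ge P.m P.m_ne hn ℓ hℓn'
    -- the bracket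
    set N' : ℝ := (1 + ε) * (‖Torus.leraySym P.m v₀‖ ^ 2 + 3 * θ * ‖v₀‖ ^ 2) + B with hN'
    have hN'0 : 0 ≤ N' := by rw [hN']; positivity
    have hb1 : ((1 + ε) * ‖Torus.leraySym (ℓ - K) v₀‖ ^ 2 + B) / (κ * (4 * Real.pi ^ 2 * freqNormSq (ℓ - K))) ≤ N' / wlow := by
      refine div_le_div₀ hN'0 ?_ hwlow0 hwm
      rw [hN']; nlinarith [mul_le_mul_of_nonneg_left hPm (by linarith : (0:ℝ) ≤ 1 + ε)]
    have hb2 : ((1 + ε) * ‖Torus.leraySym (ℓ + K) v₀‖ ^ 2 + B) / (κ * (4 * Real.pi ^ 2 * freqNormSq (ℓ + K))) ≤ N' / wlow := by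
      refine div_le_div₀ hN'0 ?_ hwlow0 hwp
      rw [hN']; nlinarith [mul_le_mul_of_nonneg_left hPp (by linarith : (0:ℝ) ≤ 1 + ε)]
    have hpre : 0 ≤ P.τ * ((1 / 2 : ℝ) * ((1 / (n : ℝ)) ^ 2 * (2 * Real.pi * ∑ i, P.e i * (ℓ i : ℝ)) ^ 2) *
        (1 / (8 * Real.pi ^ 2 * ‖latticeVec P.m‖ ^ 2))) := by have := P.τ_pos; positivity
    have hstep := mul_le_mul_of_nonneg_left (add_le_add hb1 hb2) hpre
    refine le_trans (le_of_eq (by ring)) (hstep.trans ?_)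
    -- algebra: compare with the target form
    have hS2 := slotDot_sq_le P ℓ
    have hτ0 := P.τ_pos.le
    rw [hwlow, hN', hfm]
    have hm0 : 0 < ‖latticeVec P.m‖ := by linarith
    have hkey : P.τ * (∑ i, P.e i * (ℓ i : ℝ)) ^ 2 / ‖latticeVec P.m‖ ^ 4 ≤ P.τ * freqNormSq ℓ := by
      rw [div_le_iff₀ (by positivity)]
      have h4 : 1 ≤ ‖latticeVec P.m‖ ^ 4 := one_le_pow₀ hm1
      nlinarith [mul_nonneg hτ0 (freqNormSq_nonneg ℓ), mul_le_mul_of_nonneg_left hS2 hτ0]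
    -- write both sides as multiples of `1/(8π²κn⁴(1-θ)²)`
    have e1 : P.τ * ((1 / 2 : ℝ) * ((1 / (n : ℝ)) ^ 2 * (2 * Real.pi * ∑ i, P.e i * (ℓ i : ℝ)) ^ 2) *
        (1 / (8 * Real.pi ^ 2 * ‖latticeVec P.m‖ ^ 2))) *
        (((1 + ε) * (‖Torus.leraySym P.m v₀‖ ^ 2 + 3 * θ * ‖v₀‖ ^ 2) + B) /
            (κ * (4 * Real.pi ^ 2 * ((n : ℝ) ^ 2 * ‖latticeVec P.m‖ ^ 2 * (1 - θ) ^ 2))) +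
          ((1 + ε) * (‖Torus.leraySym P.m v₀‖ ^ 2 + 3 * θ * ‖v₀‖ ^ 2) + B) /
            (κ * (4 * Real.pi ^ 2 * ((n : ℝ) ^ 2 * ‖latticeVec P.m‖ ^ 2 * (1 - θ) ^ 2)))) =
        1 / (8 * Real.pi ^ 2 * κ * (n : ℝ) ^ 4 * (1 - θ) ^ 2) *
          ((1 + ε) * (32 * Real.pi ^ 4 * (P.τ * (1 / (2 * (2 * Real.pi * ‖latticeVec P.m‖) ^ 4)) *
            (∑ i, P.e i * (ℓ i : ℝ)) ^ 2 * ‖Torus.leraySym P.m v₀‖ ^ 2)) +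
            ((1 + ε) * (3 * θ) * ‖v₀‖ ^ 2 + B) * (P.τ * (∑ i, P.e i * (ℓ i : ℝ)) ^ 2 / ‖latticeVec P.m‖ ^ 4)) := by
      field_simp
      ring
    rw [e1]
    refine mul_le_mul_of_nonneg_left ?_ (by positivity)
    have hc : 0 ≤ (1 + ε) * (3 * θ) * ‖v₀‖ ^ 2 + B := by positivity
    nlinarith [mul_le_mul_of_nonneg_left hkey hc]
  -- sum
  refine (Finset.sum_le_sum fun j _ => hterm j).trans ?_
  rw [← Finset.mul_sum, Finset.sum_add_distrib, ← Finset.mul_sum, ← Finset.mul_sum, ← Finset.mul_sum,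
    isotropic_proj_sum W hW hℓ v₀ hv₀, ← Finset.sum_mul]
  have hP : ∑ j : Fin k₀, (W.phase j).τ = W.period := rfl
  rw [hP]
  have e2 : 1 / (8 * Real.pi ^ 2 * κ * (n : ℝ) ^ 4 * (1 - θ) ^ 2) *
      ((1 + ε) * (32 * Real.pi ^ 4 * (c₀ * W.period * freqNormSq ℓ * ‖v₀‖ ^ 2)) +
        ((1 + ε) * (3 * θ) * ‖v₀‖ ^ 2 + B) * (W.period * freqNormSq ℓ)) =
      W.period * freqNormSq ℓ / (8 * Real.pi ^ 2 * κ * (n : ℝ) ^ 4 * (1 - θ) ^ 2) *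
        ((1 + ε) * (32 * Real.pi ^ 4 * c₀ + 3 * θ) * ‖v₀‖ ^ 2 + B) := by
    field_simp
    ring
  rw [e2]

end Summit.AnomalousDissipation.AnomalousDissipation.Theorems.QuasiStaticSolenoidalCellTensorQ.Negative

end
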